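import Summits.ValiantsHypothesis.ValiantsHypothesis.Theses.NewtonUnitEquations

/-!
# Disproof work file for crux `NewtonUnitEquations.DissociatedUniform` (stmt-ValiantsHypothesis-5905)

Standing disprovers: refuter-cdisprove-stmt-ValiantsHypothesis-5905-0 (cycle 1), -g2-0 (cycle 2).  Prose lives in docstrings only.

## Findings (cycle 1, 2026-08-16)

* §0  the crux elaborates; its body is KPTT's Conjecture 1 (polynomial form) RESTRICTED to dissociated frames.
* §1  reusable certificate machinery: a strict maximiser of a linear functional on a set `S` is an extreme
      point of `convexHull ℝ S` (`mem_extremePoints_convexHull_of_forall_lt`), hence explicit lower bounds on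
      the vertex count `ncard (extremePoints ℝ (convexHull ℝ (emb '' supp)))` from finitely many
      (point, functional) certificates (`card_le_ncard_extremePoints`).  Every eventual refutation of the crux
      needs exactly this to certify "many vertices".
* §2  LOAD-BEARING hypotheses (any proof must use them):
      `dissociatedUniform_false_without_card`    — drop `|A j| ≤ t`      : false (t := 0, f := Σ_{i≤2^C} X^i Y^{i²}).
      `dissociatedUniform_false_without_support` — drop `supp f_ij ⊆ A j`: false (A j := ∅, same f).
      Dropping DISSOCIATION instead gives KPTT Conj. 1 in polynomial form (`WithoutDissociation`, §2c), which
      implies the crux (`dissociatedUniform_of_withoutDissociation`) and is itself open — no cheap attack.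
* §3  WHY IT RESISTS — notes N1–N5: realisability toolkit (inverse-monoid designs: groups, CNFs,
      hitting formulas), the universal rectangle-cover recursion and what it forces on a counterexample,
      five dead families with reasons (m ≤ 3 exact; unary multi-scale; O(1)-clause CNFs; matchings;
      TI simulation of DAGs), the two live fronts (many-class abelian designs = parametric exact
      knapsack; log m-clause CNFs), and the experiment table.  VERDICT SO FAR: no kill; the crux is
      KPTT Conj. 1 (poly form) on dissociated frames and every natural design family is provably or
      empirically O(m·t + t²) per level set.

## Findings (cycle 2, 2026-08-16, g2 seat) — see §4

* §4.1 Lean: unions never amplify (`extremePoints_convexHull_union_subset`, counting form).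
* §4.2 load-bearing table complete: `k` cannot be deleted from the base (tree file
      `Theorems/DissociatedUniform/Negative/WithoutK.lean`, digit-frame kit reusable for refutations).
* §4.3 notes N6 (census ⇒ crux ≈ Conjecture K up to poly factors), N7 (Lagrangian normalisation:
      defects ≤ 2S+1, live window S ∈ [log m, poly m], pencil of defect PROFILES is the residual object),
      N8 (slot/translate analysis: amplification is one-shot; what a counterexample must look like),
      N9 (data; the C = 1 form `V ≤ kmt+2` = `DissociatedSharp` survives everything computed so far),
      N10 ((min,+)/support-function form of the recursion; two-block additivity is a theorem; the three
      reductions funnelling every abelian-design refutation into ONE object: a q^ω(1) corner pencil).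
-/

set_option linter.dupNamespace false

namespace Summit.ValiantsHypothesis.ValiantsHypothesis.Cruxes.DissociatedUniform.Disproof

open scoped BigOperators
open MvPolynomial

/-! ## §0 Probe -/

/-- The crux decl, by name (elaboration probe; the body is restated verbatim in `WithoutCard` etc. below). -/
example : Summit.ValiantsHypothesis.ValiantsHypothesis.Theses.NewtonUnitEquations.DissociatedUniform ↔
    ∃ C : ℕ, ∀ (k m t : ℕ) (A : Fin m → Finset (Fin 2 →₀ ℕ)) (f : Fin k → Fin m → MvPolynomial (Fin 2) ℂ),
      (∀ j, (A j).card ≤ t) → (∀ i j, (f i j).support ⊆ A j) →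
      (∀ a b : Fin m → (Fin 2 →₀ ℕ), (∀ j, a j ∈ A j) → (∀ j, b j ∈ A j) → ∑ j, a j = ∑ j, b j → a = b) →
      (Set.extremePoints ℝ (convexHull ℝ ((fun e : Fin 2 →₀ ℕ => fun i : Fin 2 => ((e i : ℕ) : ℝ)) ''
        ((∑ i, ∏ j, f i j).support : Set (Fin 2 →₀ ℕ))))).ncard ≤ (k * m * t + 2) ^ C :=
  Iff.rfl

/-! ## §1 Certificate machinery: strict maximisers are extreme points -/

/-- A point of `S` that is the STRICT maximiser on `S` of some linear functional is an extreme point of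
`convexHull ℝ S` (no finiteness or topology needed). -/
theorem mem_extremePoints_convexHull_of_forall_lt {E : Type*} [AddCommGroup E] [Module ℝ E]
    {S : Set E} {p : E} (hp : p ∈ S) (l : E →ₗ[ℝ] ℝ) (hl : ∀ q ∈ S, q ≠ p → l q < l p) :
    p ∈ (convexHull ℝ S).extremePoints ℝ := by
  -- every point of the hull is below `l p`
  have hle : ∀ y ∈ convexHull ℝ S, l y ≤ l p := by
    intro y hy
    have hsub : S ⊆ {y | l y ≤ l p} := by
      intro q hq
      show l q ≤ l p
      rcases eq_or_ne q p with rfl | h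
      · exact le_rfl
      · exact (hl q hq h).le
    exact convexHull_min hsub (convex_halfSpace_le l.isLinear (l p)) hy
  -- and the level `l p` is attained only at `p`
  have heq : ∀ y ∈ convexHull ℝ S, l p ≤ l y → y = p := by
    intro y hy hge
    have hS : S = insert p (S \ {p}) := by
      ext x
      by_cases hx : x = p <;> simp [hx, hp]
    by_cases hne : (S \ {p}).Nonempty
    · rw [hS, convexHull_insert hne, mem_convexJoin] at hy
      obtain ⟨a, ha, b, hb, hyab⟩ := hy
      rw [Set.mem_singleton_iff] at ha
      subst ha
      have hsub : S \ {a} ⊆ {y | l y < l a} := fun q hq => hl q hq.1 hq.2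
      have hb' : l b < l a := convexHull_min hsub (convex_halfSpace_lt l.isLinear _) hb
      obtain ⟨α, β, hα, hβ, hαβ, rfl⟩ := hyab
      have hβ0 : β = 0 := by
        by_contra hβ0
        have hβpos : 0 < β := lt_of_le_of_ne hβ (Ne.symm hβ0)
        have hlt : l (α • a + β • b) < l a := by
          simp only [map_add, map_smul, smul_eq_mul]
          have h1 : α = 1 - β := by linarith
          have h2 : 0 < β * (l a - l b) := mul_pos hβpos (sub_pos.mpr hb')
          have h3 : (1 - β) * l a + β * l b = l a - β * (l a - l b) := by ring
          rw [h1, h3]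
          linarith
        exact absurd hge (not_le.mpr hlt)
      subst hβ0
      have hα1 : α = 1 := by linarith
      subst hα1
      simp
    · rw [Set.not_nonempty_iff_eq_empty] at hne
      have hS' : S = {p} := by rw [hS, hne]; simp
      rw [hS', convexHull_singleton] at hy
      exact hy
  rw [mem_extremePoints]
  refine ⟨subset_convexHull ℝ S hp, fun x₁ hx₁ x₂ hx₂ hx => ?_⟩
  obtain ⟨a, b, ha, hb, hab, hx'⟩ := hx
  have h1 := hle x₁ hx₁
  have h2 := hle x₂ hx₂
  have e1 : l p = a * l x₁ + b * l x₂ := by rw [← hx']; simp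
  have hsum : a * l p + b * l p = l p := by rw [← add_mul, hab, one_mul]
  have h1' : l p ≤ l x₁ := by
    by_contra hlt
    push Not at hlt
    have t1 : 0 < a * l p - a * l x₁ := by
      have := mul_pos ha (sub_pos.mpr hlt); linarith [mul_sub a (l p) (l x₁)]
    have t2 : 0 ≤ b * l p - b * l x₂ := by
      have := mul_nonneg hb.le (sub_nonneg.mpr h2); linarith [mul_sub b (l p) (l x₂)]
    linarith
  have h2' : l p ≤ l x₂ := by
    by_contra hlt
    push Not at hlt
    have t1 : 0 < b * l p - b * l x₂ := by
      have := mul_pos hb (sub_pos.mpr hlt); linarith [mul_sub b (l p) (l x₂)]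
    have t2 : 0 ≤ a * l p - a * l x₁ := by
      have := mul_nonneg ha.le (sub_nonneg.mpr h1); linarith [mul_sub a (l p) (l x₁)]
    linarith
  exact ⟨heq x₁ hx₁ h1', heq x₂ hx₂ h2'⟩

/-- Counting form: finitely many certified extreme points bound the vertex count from below. -/
theorem card_le_ncard_extremePoints {E : Type*} [AddCommGroup E] [Module ℝ E]
    {S : Set E} (hS : S.Finite) (P : Finset E)
    (hP : ∀ p ∈ P, p ∈ (convexHull ℝ S).extremePoints ℝ) :
    P.card ≤ ((convexHull ℝ S).extremePoints ℝ).ncard := by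
  rw [← Set.ncard_coe_finset]
  exact Set.ncard_le_ncard (fun p hp => hP p hp) (hS.subset extremePoints_convexHull_subset)

/-! ## §2 Load-bearing hypotheses -/

/-- The planar embedding of exponents used by the crux. -/
def emb (e : Fin 2 →₀ ℕ) : Fin 2 → ℝ := fun i => ((e i : ℕ) : ℝ)

/-- Exponent of the witness monomial `X^i Y^{i²}`. -/
noncomputable def ex (i : ℕ) : Fin 2 →₀ ℕ := Finsupp.single 0 i + Finsupp.single 1 (i ^ 2)

@[simp] lemma ex_zero (i : ℕ) : ex i 0 = i := by simp [ex]
@[simp] lemma ex_one (i : ℕ) : ex i 1 = i ^ 2 := by simp [ex]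

lemma ex_injective : Function.Injective ex := by
  intro i j h
  have := congrArg (fun e : Fin 2 →₀ ℕ => e 0) h
  simpa using this

/-- The witness `Σ_{i<V} X^i Y^{i²}`: `V` monomials on a strictly convex curve. -/
noncomputable def wit (V : ℕ) : MvPolynomial (Fin 2) ℂ :=
  ∑ i ∈ Finset.range V, MvPolynomial.monomial (ex i) 1

lemma coeff_wit_ex (V i : ℕ) (hi : i < V) : coeff (ex i) (wit V) = 1 := by
  classical
  unfold wit
  rw [coeff_sum, Finset.sum_eq_single i]
  · simp
  · intro j _ hji
    rw [coeff_monomial, if_neg]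
    exact fun h => hji (ex_injective h)
  · intro h; exact absurd (Finset.mem_range.mpr hi) h

lemma coeff_wit_of_not_mem (V : ℕ) (d : Fin 2 →₀ ℕ) (hd : d ∉ (Finset.range V).image ex) :
    coeff d (wit V) = 0 := by
  classical
  unfold wit
  rw [coeff_sum]
  refine Finset.sum_eq_zero fun j hj => ?_
  rw [coeff_monomial, if_neg]
  rintro rfl
  exact hd (Finset.mem_image_of_mem ex hj)

lemma support_wit (V : ℕ) : (wit V).support = (Finset.range V).image ex := by
  classical
  ext d
  rw [MvPolynomial.mem_support_iff]
  constructor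
  · intro h
    by_contra hd
    exact h (coeff_wit_of_not_mem V d hd)
  · intro hd
    obtain ⟨i, hi, rfl⟩ := Finset.mem_image.mp hd
    rw [coeff_wit_ex V i (Finset.mem_range.mp hi)]
    exact one_ne_zero

/-- The exposing functional of the `i`-th witness point: `(x, y) ↦ 2 i x − y`. -/
noncomputable def expose (i : ℕ) : (Fin 2 → ℝ) →ₗ[ℝ] ℝ :=
  (2 * (i : ℝ)) • LinearMap.proj 0 - LinearMap.proj 1

lemma expose_emb_ex (i j : ℕ) : expose i (emb (ex j)) = 2 * i * j - (j : ℝ) ^ 2 := by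
  simp [expose, emb, mul_assoc]

/-- Every witness point is a vertex of the Newton polygon of `wit V`. -/
lemma emb_ex_mem_extremePoints (V i : ℕ) (hi : i < V) :
    emb (ex i) ∈ (convexHull ℝ (emb '' ((wit V).support : Set (Fin 2 →₀ ℕ)))).extremePoints ℝ := by
  classical
  apply mem_extremePoints_convexHull_of_forall_lt (l := expose i)
  · refine ⟨ex i, ?_, rfl⟩
    rw [Finset.mem_coe, support_wit]
    exact Finset.mem_image_of_mem ex (Finset.mem_range.mpr hi)
  · rintro q ⟨d, hd, rfl⟩ hne
    rw [Finset.mem_coe, support_wit, Finset.mem_image] at hd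
    obtain ⟨j, -, rfl⟩ := hd
    have hij : (i : ℝ) ≠ j := by
      intro h
      have : i = j := by exact_mod_cast h
      exact hne (by rw [this])
    rw [expose_emb_ex, expose_emb_ex]
    have : 0 < ((i : ℝ) - j) ^ 2 := by
      have : (i : ℝ) - j ≠ 0 := sub_ne_zero.mpr hij
      positivity
    nlinarith

/-- The witness has at least `V` Newton-polygon vertices. -/
theorem le_ncard_extremePoints_wit (V : ℕ) :
    V ≤ ((convexHull ℝ (emb '' ((wit V).support : Set (Fin 2 →₀ ℕ)))).extremePoints ℝ).ncard := by
  classical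
  have hcard : ((Finset.range V).image (emb ∘ ex)).card = V := by
    rw [Finset.card_image_of_injective _ ?_, Finset.card_range]
    intro i j h
    have h0 := congrFun h 0
    simp only [Function.comp_apply, emb, ex_zero, Nat.cast_inj] at h0
    exact h0
  have h := card_le_ncard_extremePoints ((wit V).support.finite_toSet.image emb)
    ((Finset.range V).image (emb ∘ ex)) (by
      intro p hp
      obtain ⟨i, hi, rfl⟩ := Finset.mem_image.mp hp
      exact emb_ex_mem_extremePoints V i (Finset.mem_range.mp hi))
  rwa [hcard] at h

/-- §2a  The crux with the alphabet-size hypothesis `∀ j, (A j).card ≤ t` DROPPED. -/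
def WithoutCard : Prop :=
  ∃ C : ℕ, ∀ (k m t : ℕ) (A : Fin m → Finset (Fin 2 →₀ ℕ)) (f : Fin k → Fin m → MvPolynomial (Fin 2) ℂ),
    (∀ i j, (f i j).support ⊆ A j) →
    (∀ a b : Fin m → (Fin 2 →₀ ℕ), (∀ j, a j ∈ A j) → (∀ j, b j ∈ A j) → ∑ j, a j = ∑ j, b j → a = b) →
    (Set.extremePoints ℝ (convexHull ℝ ((fun e : Fin 2 →₀ ℕ => fun i : Fin 2 => ((e i : ℕ) : ℝ)) ''
      ((∑ i, ∏ j, f i j).support : Set (Fin 2 →₀ ℕ))))).ncard ≤ (k * m * t + 2) ^ C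

/-- §2b  The crux with the support hypothesis `∀ i j, (f i j).support ⊆ A j` DROPPED. -/
def WithoutSupport : Prop :=
  ∃ C : ℕ, ∀ (k m t : ℕ) (A : Fin m → Finset (Fin 2 →₀ ℕ)) (f : Fin k → Fin m → MvPolynomial (Fin 2) ℂ),
    (∀ j, (A j).card ≤ t) →
    (∀ a b : Fin m → (Fin 2 →₀ ℕ), (∀ j, a j ∈ A j) → (∀ j, b j ∈ A j) → ∑ j, a j = ∑ j, b j → a = b) →
    (Set.extremePoints ℝ (convexHull ℝ ((fun e : Fin 2 →₀ ℕ => fun i : Fin 2 => ((e i : ℕ) : ℝ)) ''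
      ((∑ i, ∏ j, f i j).support : Set (Fin 2 →₀ ℕ))))).ncard ≤ (k * m * t + 2) ^ C

/-- §2c  The crux with DISSOCIATION dropped = KPTT Conjecture 1 (arXiv:1308.2286) in POLYNOMIAL form
(`t`-sparse factors written as supports inside alphabets of size `≤ t`).  Open; it implies the crux. -/
def WithoutDissociation : Prop :=
  ∃ C : ℕ, ∀ (k m t : ℕ) (A : Fin m → Finset (Fin 2 →₀ ℕ)) (f : Fin k → Fin m → MvPolynomial (Fin 2) ℂ),
    (∀ j, (A j).card ≤ t) → (∀ i j, (f i j).support ⊆ A j) →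
    (Set.extremePoints ℝ (convexHull ℝ ((fun e : Fin 2 →₀ ℕ => fun i : Fin 2 => ((e i : ℕ) : ℝ)) ''
      ((∑ i, ∏ j, f i j).support : Set (Fin 2 →₀ ℕ))))).ncard ≤ (k * m * t + 2) ^ C

/-- Dropping dissociation only strengthens the statement (bookkeeping for the hierarchy
`WithoutDissociation → DissociatedUniform`; the converse direction is where a refutation of the crux would
also refute KPTT Conj. 1 in polynomial form). -/
theorem dissociatedUniform_of_withoutDissociation (h : WithoutDissociation) :
    Summit.ValiantsHypothesis.ValiantsHypothesis.Theses.NewtonUnitEquations.DissociatedUniform := by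
  obtain ⟨C, hC⟩ := h
  exact ⟨C, fun k m t A f hcard hsupp _ => hC k m t A f hcard hsupp⟩

/-- The one-factor instance `k = m = 1`, `f 0 0 = wit V`: the sum of products is `wit V`. -/
lemma sum_prod_const_wit (V : ℕ) :
    (∑ i : Fin 1, ∏ j : Fin 1, (fun (_ : Fin 1) (_ : Fin 1) => wit V) i j) = wit V := by
  simp

/-- `2 ^ C < 2 ^ C + 1 ≤ #vertices (wit (2^C+1))`, packaged against the crux's bound at `k = m = 1, t = 0`. -/
lemma bound_violated (C : ℕ) :
    ¬ ((Set.extremePoints ℝ (convexHull ℝ ((fun e : Fin 2 →₀ ℕ => fun i : Fin 2 => ((e i : ℕ) : ℝ)) ''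
      ((∑ i : Fin 1, ∏ j : Fin 1, (fun (_ : Fin 1) (_ : Fin 1) => wit (2 ^ C + 1)) i j).support :
        Set (Fin 2 →₀ ℕ))))).ncard ≤ (1 * 1 * 0 + 2) ^ C) := by
  rw [sum_prod_const_wit]
  have h := le_ncard_extremePoints_wit (2 ^ C + 1)
  change 2 ^ C + 1 ≤ ((convexHull ℝ ((fun e : Fin 2 →₀ ℕ => fun i : Fin 2 => ((e i : ℕ) : ℝ)) ''
      ((wit (2 ^ C + 1)).support : Set (Fin 2 →₀ ℕ)))).extremePoints ℝ).ncard at h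
  simp only [one_mul, zero_add]
  omega

/-- **Load-bearing (a): any proof of the crux must use `∀ j, (A j).card ≤ t`.**
Witness: `k = m = 1`, `t = 0`, `A 0 = supp f`, `f 0 0 = Σ_{i ≤ 2^C} X^i Y^{i²}` — a dissociated one-letter-per-
point frame whose Newton polygon has `2^C + 1 > (1·1·0+2)^C` vertices. -/
theorem dissociatedUniform_false_without_card : ¬ WithoutCard := by
  rintro ⟨C, hC⟩
  refine bound_violated C (hC 1 1 0 (fun _ => (wit (2 ^ C + 1)).support)
    (fun _ _ => wit (2 ^ C + 1)) (fun _ _ => subset_rfl) ?_)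
  intro a b ha hb hsum
  funext j
  have hj : j = 0 := Subsingleton.elim j 0
  subst hj
  simpa using hsum

/-- **Load-bearing (b): any proof of the crux must use `∀ i j, (f i j).support ⊆ A j`.**
Witness: `k = m = 1`, `t = 0`, `A 0 = ∅` (so `|A 0| ≤ 0` and dissociation is vacuous), same `f`. -/
theorem dissociatedUniform_false_without_support : ¬ WithoutSupport := by
  rintro ⟨C, hC⟩
  refine bound_violated C (hC 1 1 0 (fun _ => ∅) (fun _ _ => wit (2 ^ C + 1)) (fun _ => by simp) ?_)
  intro a b ha hb hsum
  exact absurd (ha 0) (by simp)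

/-! ## §3 Why it resists — map of the attack space (notes for provers; updated every cycle)

Everything below is prose (docstrings on `True` facts) except where stated; numbers are from exact
parametric-DP computations (`kit/tidp.py`, `kit/ordp.py` in the disprover folder; kit job j009491). -/

/-- **N1. Realisability toolkit (which survivor sets `Ω ⊆ Π_j A_j` are supports of rank-≤k tensors).**
(a) *Commutative inverse-monoid designs*: `T(a) = f(ψ_1(a_1)·…·ψ_m(a_m))` with `ψ_j : A_j → M`, `M` a
finite commutative INVERSE monoid (finite abelian group; semilattice; semilattice of groups), any
`f : M → ℂ`: rank ≤ `|M|` (ℂ[M] is semisimple, the translation operators diagonalise simultaneously).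
Groups `ℤ/q`: survivors = level sets of an additive weight (the "character designs" everybody probed).
Semilattice `(2^[s], ∪)`: survivors = MODELS OF A CNF with `s` clauses (each box `Π_j B_j` is the
falsifying set of a clause), rank ≤ `2^s`; more precisely rank ≤ `#{U ⊆ clauses : ⋂_{σ∈U} box_σ ≠ ∅}`
(inclusion–exclusion over the nerve), so a CNF in which every assignment falsifies ≤ `d` clauses has
rank ≤ `Σ_{i≤d} C(s,i)` — e.g. HITTING formulas (pairwise clashing clauses), rank ≤ `s+1` for ANY
number `s` of clauses.  (b) Sparse-spectrum `f` on a big group: zero sets are essentially coset unions.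
(c) Closure: unions cost additive rank, intersections multiplicative rank.  (d) Non-design (torsion-free)
factor vectors: zero sets are incidence-bounded (Szemerédi–Trotter type), small — large zero sets need
massively repeated factor vectors, i.e. designs.  Upshot: the battlefield is (a)+(c). -/
theorem note_realisability : True := trivial

/-- **N2. The one universal upper bound and what it forces.**  For any `Ω` and any bipartition of the
coordinates, `Ω = ⋃_τ Ω¹_τ × Ω²_τ` over a rectangle cover of its membership matrix, and
`#vert(Ω) ≤ Σ_τ (#vert Ω¹_τ + #vert Ω²_τ) ≤ 2·rc·max`, recursively: `#vert ≤ t·Π_levels (2·rc_level)`.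
For groups `rc = q` (quasi-poly `t(2q+2)^{⌈log₂ m⌉}` = the shape of the ideator's Theorem Q); for
bipartite perfect matchings of `K_{n,n}` (a design over `(2^[2n],∪) × ℤ`, `k = 2^{Θ(n)}`) the reachable
interface at a balanced split is only `C(n,n/2)`, so `SV(n) := #shadow vertices of the Birkhoff polytope
≤ n·4^n ≤ poly(k)` — although `SV(n) ≥ n^{Ω(log n)}` (Carstensen's parametric shortest path embeds in
assignment).  CONSEQUENCE: a counterexample needs rectangle-cover ≈ k at EVERY scale of a recursive
bipartition AND geometric tightness at every level; consecutive hull vertices must then differ in an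
unbounded number of coordinates, realising super-polynomially many distinct difference directions.
In a `ℤ/q` design a hull edge exchanging ≥ q+1 letters splits (Davenport) into zero-sum blocks of
≤ q letters whose difference vectors are all PARALLEL to the edge and point the same way (else an
intermediate same-class word lies beyond an endpoint) — for q bounded this alone gives `(mt²)^{O(q)}`. -/
theorem note_recursion : True := trivial

/-- **N3. Dead counterexample families (with the reason).**
1. `m ≤ 2`: every level set has ≤ 2t vertices for every k (`P_w = ⋃_u A¹_u ⊕ A²_{w-u}` and the `A¹_u`
   partition `A_1`).  `m = 3`: ≤ t², ATTAINED up to 3/4: with weights `ψ_j(l) = l` every quadratic in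
   the two free letters is fibre-additive (`l₁l₂ = ((l₁+l₂)² − l₁² − l₂²)/2`, `l₁+l₂ = u − l₃`), so the
   whole middle fibre sits on a parabola (`3t²/4` vertices, `k = 3t−2`: 12, 27, 48, 75 for t = 4..10) —
   still far below `kmt+2 = 9t²−6t+2` (even `C = 1` is not threatened).  `m ≥ 4`: mixed second
   differences `∂_i∂_j G(X) = a_i a_j G''` must be equal for all pairs ⇒ no fibre lies on a strictly
   convex curve; composing two parabola 3-blocks (m = 6) gives 32, 65, 110, 168, 237 (t = 4..12) ≈ 2.3×
   one block: ADDITIVE, as N2's sector argument predicts (the fibres of a block cannot all be rich in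
   fibre-specific directions: their union is the block's plain sumset, ≤ 3t hull vertices).
2. UNARY multi-scale designs (t = 2 items, weights 2^l): along every residue class the DP value is a
   (max,+)-convolution of CONCAVE sequences at every scale, the optimum is a profile intersection whose
   total variation is linear; measured ≈ 0.6–1.6·m.  The explicit 2-scale "quiet lines + divers +
   staircase selector" construction is capped by rank density (≤ σ catches per step): ≈ 0.6·m.
3. CNF designs with `s = O(1)` clauses: the optimal model differs from the unconstrained optimum in ≤ s
   witness flips; feasibility depends only on type counts (≤ 2·3^s types); the cost of "r cheapest of a
   type" is a level of a line arrangement within ≤ s levels of the zero line (Clarkson–Shor O(ns)) ⇒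
   `#vert = O_s(m)`.  Parametric set cover on a universe of size s ≤ 9 (hill-climbed): ≤ 13 breakpoints.
4. Perfect matchings / assignment (rank `2^{Θ(n)}`): `SV(n) ≤ n·4^n` (N2) — dead by arithmetic, even
   though local search finds SV(4) ≥ 16, SV(5) ≥ 26, SV(6) ≥ 33.
5. Translation-invariant simulation of a general layered DAG (where `n^{Θ(log n)}` breakpoints live)
   needs an exponential abelian group: the path tensor's interleaved flattening has rank `n^{ℓ−1}`.
   Read in Mulmuley–Shah (doi:10.1109/ccc.2000.856731, §4.4–4.5): `G_{m,n}` = `G_{m−1,n}` + its reversal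
   + `G_{m−1,2n−1}`, glued by SHIFT edges `i → i+r` whose weights contain the bilinear term
   `−N(K₂/K₁)·i·r` — a state × letter interaction, exactly what an additive (abelian, letter-only) design
   cannot express; their gain "×n per level" is carried by that term.
6. TWO weight classes (`s = 2`, weights 1 and 2): with the weight-1 class flat, the profile `b*(x)` is the
   h-index of the scores `#{thresholds below line l}`; EXHAUSTIVE search of the abstract dynamics
   (monotone unit-step scores, n ≤ 8) and line searches (n ≤ 24, up to 5n thresholds) give total
   variation `TV(h) = n` exactly as the maximum (conjecturally `#up-events ≤ #risers`, `#down ≤ #fallers`):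
   profile switches are linear, so `s = 2` designs are `O(m²)` at worst and ≈ 2.6·m in searches. -/
theorem note_dead_families : True := trivial

/-- **N4. Where a counterexample could still live.**  (i) ABELIAN designs with many weight classes
(`s ≈ log m … m`): hull vertices ↔ breakpoints of a parametric EXACT-KNAPSACK with pseudo-polynomial
weights; reduction (this seat): only the `O(s²)` items nearest the marginal-ratio level matter up to
poly(m) factors, the greedy profile changes `O(m²)` times (weighted level of a line arrangement) and all
further breakpoints are changes of the INTEGER CORRECTION inside a proximity box of radius `O(s²)`
(Hochbaum–Shanthikumar), i.e. `#vert ≤ O(m²) + TV(correction)`; for `s = 1` this is the k-set bound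
`O(m·w^{1/3})`, for `s = 2` it is `Σ_n zeros(level_{n+1}(𝒜₂) − level-pair sums of 𝒜₁) = O(m²)`;
whether the exponent grows with `s` (⇒ `m^{Ω(log m)}` at `s ≈ log m`, refuting the crux and KPTT
Conj. 1 in polynomial form) or stays bounded (⇒ Conjecture K, the design stratum of stub D of line
`greedy-basis-shadow`) is THE open question; hill-climbed `s = 2` designs give only ≈ 2.6·m (m ≤ 32).
(ii) CNF designs with `s ≈ log m` clauses (`3^s` types) and bounded-overlap CNFs with poly many clauses
(rank `s^d`): the optimal model is the unconstrained optimum plus a min-cost "repair chain" through the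
maze of falsifying boxes; no construction with super-constant gain per extra clause is known to us.
(iii) Literature to fetch when searchd is back: Carstensen 1983 (Math. Programming 26) / Gusfield 1980 /
Mulmuley–Shah 2001 (doi:10.1006/jcss.2001.1766) on parametric shortest path & knapsack breakpoints;
bi-objective knapsack "extreme supported" counts (Visée–Teghem–Pirlot–Ulungu 1998; Ehrgott). -/
theorem note_live_fronts : True := trivial

/-- **N5. Experiment table (exact hull DP; V = max over level sets / fibres of #hull vertices).**
random unary multi-scale (t=2, m ≤ 64, K ≤ 240): V ≤ 1.55·m · 2-scale diver construction (m ≤ 422):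
V ≤ 1.2·m · local search general TI (t=3, m=8, K ≤ 48): 26 · index-weight designs m = 3/4/5, t = 5..8
(searched): 19/23/27 (explicit parabola m=3: 3t²/4) · s=2 two-class designs m = 16/24/32: 38/66/84 ·
CNF random (s ≤ 9, N = 80): hull = 2N (constraint never binds), set-cover breakpoints ≤ 13 ·
Birkhoff shadows: 16/26/33 for n = 4/5/6.  Nothing super-linear in m beyond the additive t² term. -/
theorem note_experiments : True := trivial


/-! ## §4 Cycle 2 (2026-08-16, refuter-cdisprove-stmt-ValiantsHypothesis-5905-g2-0)

Summary of the cycle: (a) fourth load-bearing entry — `k` cannot be deleted from the base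
(`Theorems/DissociatedUniform/Negative/WithoutK.lean`, `dissociatedUniform_false_without_k`, with a
reusable Lean kit for DISSOCIATED BINARY DIGIT FRAMES: `digitFrame_dissociated`,
`patternMonomials` / `support_sum_prod_patternMonomials` (ANY injective family of bit patterns realised
as monomial products with support exactly the pattern exponents), `sum_prod_digitMonomials` — every
candidate design below lives on such a frame, so a future refutation only has to supply the survivor
set `S` and its vertex certificates (§1)); (b) the Lean lemma "unions never
amplify" (`extremePoints_convexHull_union_subset`, `ncard_extremePoints_convexHull_union_le`);
(c) notes N6–N9: realisability census ⇒ the crux is Conjecture K up to poly factors; Lagrangian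
normalisation ⇒ defects of size ≤ 2S+1 and the live window `S ∈ [log m, poly(m)]`; the slot/translate
analysis explaining why every explicit amplification is one-shot; new data (parity `V = 3m−4`,
annealed `k = 2` designs `V ≤ 0.71·(kmt+2)`, corner pencils on fixed supports ≤ 7 up to q = 25601):
even the `C = 1` form `V ≤ kmt + 2` is not threatened by anything found so far. -/

/-! ### §4.1 Unions never amplify (Lean) -/

/-- **An extreme point of `conv (A ∪ B)` is an extreme point of `conv A` or of `conv B`.**
Rank is (sub)additive under sums of tensors with disjoint alive patterns, whose survivor set is the
UNION of the survivor sets; this is the matching subadditivity of the vertex count, so the union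
closure of the realisability toolkit (N1(c)) never manufactures vertices: `V(S₁ ∪ S₂) ≤ V(S₁) + V(S₂)`
while `rank ≤ rank₁ + rank₂`.  (Use with `Set.image_union` for the crux's `emb '' supp` shape.) -/
theorem extremePoints_convexHull_union_subset {E : Type*} [AddCommGroup E] [Module ℝ E] (A B : Set E) :
    (convexHull ℝ (A ∪ B)).extremePoints ℝ ⊆
      (convexHull ℝ A).extremePoints ℝ ∪ (convexHull ℝ B).extremePoints ℝ := by
  intro x hx
  have hxAB : x ∈ A ∪ B := extremePoints_convexHull_subset hx
  have key : ∀ S : Set E, x ∈ S → convexHull ℝ S ⊆ convexHull ℝ (A ∪ B) →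
      x ∈ (convexHull ℝ S).extremePoints ℝ := by
    intro S hxS hsub
    rw [mem_extremePoints] at hx ⊢
    exact ⟨subset_convexHull ℝ S hxS, fun x₁ h₁ x₂ h₂ hseg => hx.2 x₁ (hsub h₁) x₂ (hsub h₂) hseg⟩
  rcases hxAB with h | h
  · exact Or.inl (key A h (convexHull_mono Set.subset_union_left))
  · exact Or.inr (key B h (convexHull_mono Set.subset_union_right))

/-- Counting form: `#vert conv(A ∪ B) ≤ #vert conv A + #vert conv B` for finite `A, B`. -/
theorem ncard_extremePoints_convexHull_union_le {E : Type*} [AddCommGroup E] [Module ℝ E]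
    {A B : Set E} (hA : A.Finite) (hB : B.Finite) :
    ((convexHull ℝ (A ∪ B)).extremePoints ℝ).ncard ≤
      ((convexHull ℝ A).extremePoints ℝ).ncard + ((convexHull ℝ B).extremePoints ℝ).ncard := by
  have hfA : ((convexHull ℝ A).extremePoints ℝ).Finite := hA.subset extremePoints_convexHull_subset
  have hfB : ((convexHull ℝ B).extremePoints ℝ).Finite := hB.subset extremePoints_convexHull_subset
  calc ((convexHull ℝ (A ∪ B)).extremePoints ℝ).ncard
      ≤ ((convexHull ℝ A).extremePoints ℝ ∪ (convexHull ℝ B).extremePoints ℝ).ncard :=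
        Set.ncard_le_ncard (extremePoints_convexHull_union_subset A B) (hfA.union hfB)
    _ ≤ _ := Set.ncard_union_le _ _

/-! ### §4.2 Load-bearing (d): the rank `k` (landed separately) and the trivial entries `m`, `t` -/

/-- **N-LB. Load-bearing table, now complete.**  Dropping a hypothesis / a parameter of the bound:
* `#A j ≤ t` dropped — FALSE (§2a; tree `Negative.LoadBearing`).
* `supp f_ij ⊆ A j` dropped — FALSE (§2b; tree).
* dissociation dropped — KPTT Conj. 1 in polynomial form, OPEN ("believed false", CGT 2023) (§2c).
* `k` deleted from the base, bound `(m·t+2)^C` — FALSE: `Negative/WithoutK.lean`,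
  `dissociatedUniform_false_without_k` (this cycle; rc0, axioms {propext, choice, Quot.sound}).
  Witness = KPTT Prop. 1's digit grid made dissociated: binary digit frame on `m = n + (2n+3)`
  coordinates, `t = 2`, `k = 2^n` products of monomials writing `X^i Y^{2i(2^n−1−i)}` digit by digit;
  the sum is `KPTT.kpttPoly n` with `2^n` vertices `> (6n+8)^C` at `n = 2^(2C+8)`.  Reading: on
  dissociated frames `V` can be as large as `k` with `m = O(log k)`; the crux is exactly the passage
  `exp(k) → poly(k)` and nothing weaker than a genuine power of `k` can sit in the base.
* `m` deleted, bound `(k·t+2)^C` — FALSE trivially: `k = 1`, `t = 2`, `A j = {0, d_j}` with `m` generic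
  segments: the zonogon has `2m` vertices.  `t` deleted, `(k·m+2)^C` — FALSE trivially: `k = m = 1`,
  `V = t` (this is §2a's witness).  (Not formalised: no content.)
So every symbol of `(k·m·t+2)^C` and every hypothesis except dissociation is individually necessary,
and dissociation is where KPTT's conjecture itself sits. -/
theorem note_load_bearing_table : True := trivial

/-! ### §4.3 Why it resists, continued (notes N6–N9) -/

/-- **N6. Realisability census ⇒ the crux is Conjecture K up to polynomial factors.**
(a) SMALL-IMAGE ADDITIVE DESIGNS subsume N1(a): for ANY additive map `Λ(a) = Σ_j λ_j(a_j)` into an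
abelian group with `N = |Λ(Π_j A_j)|` values on the frame and ANY `U ⊆ image`, the survivor set
`Λ⁻¹(U)` has rank ≤ `N` (interpolate `𝟙_U` on the image by `N` exponentials/characters; generic bases
give an invertible `N × N` system).  Residue designs (`Λ mod q`), integer-weight designs (interpolation
over the range), vector labels (mixed radix) are all instances; by Freiman-type structure a small image
forces `Λ` to be, up to isomorphism, a vector of `d = O(log k / log m) = O(C)` integer knapsack
constraints with weights `≤ poly`.  (b) `Λ⁻¹(U)` is a UNION of ≤ `N` level sets and unions are
vertex-subadditive (§4.1) ⇒ `V(Λ⁻¹ U) ≤ N · max_v V(Λ⁻¹ v)`.  (c) Couplings through the semilattice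
part (survivors `{Λ(a) ∈ U_{Φ(a)}}`, `Φ(a)` = set of satisfied clauses of an `s`-clause CNF, rank
≤ `2^s · |G|`) decompose into `2^s = poly` boxes × level-set problems ⇒ again poly × (level-set count).
(d) Non-design coefficients: by Evertse–Schlickewei–Schmidt the zero set is a finite union of
(alive-box ∩ level set of a multiplicative `Λ` into `Γ^{B}`); deep survivors need `Λ` with small image
(else killed words are sporadic and cannot cover the upper sets above a chain for every direction) ⇒
back to (a).  For `k ≳ log m` the ESS count no longer restricts anything, but no realisation
mechanism outside (a)–(c) is known to anyone on this crux (5 ideator cards, 3 triages, 2 disprover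
cycles).  UPSHOT: `DissociatedUniform ⇐ poly(k,m,t) · K` where K = LevelSetVertexBound (level sets of
integer additive maps with ≤ k values have poly(k,m,t) hull vertices); a refutation of the crux inside
the known toolkit IS a refutation of K, i.e. a level set with super-polynomially many vertices. -/
theorem note_census : True := trivial

/-- **N7. Lagrangian normalisation: defects have size ≤ 2S+1; the live window is S ∈ [log m, poly(m)].**
For an integer-weight level set `{Σ_j s_j(a_j) = r}`, weights in `[0,S]` (rank `≤ mS+1`), the `w`-top
survivor maximises `Σ_j (u_j − μ s_j)(a_j)` for EVERY multiplier `μ` (the level is fixed), so take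
`μ` = the LP dual: the survivor is the sign-greedy word `L(w, μ)` corrected by a defect `E` with
`|E| ≤ 2S+1` letters (Eisenbrand–Weismantel proximity for one equality row, `‖z* − x*‖₁ ≤ 2Δ+1`;
uniqueness of the top word for generic `w` makes "some optimal solution" = "the" one).  `L(w, μ(w))`
is a weighted level of the arrangement of the `m·t` sinusoids `u_j(l)/s_j(l)` ⇒ changes poly(m,t)
times; hence `V ≤ poly(m,t) · P` where `P` = the number of distinct min-cost BALANCED DEFECTS along a
linear pencil of costs: ≤ `2S+1` coins drawn from ≤ `2S·t` (type, side) classes, cheapest-first inside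
a class (t = 2; for t > 2 one letter-change per coordinate makes the in-class choice a small assignment
problem, still poly for a fixed profile).  Consequences: `S = O(1)` ⇒ poly (= idea lagrangian-lift's theorem, re-derived);
`S = O(√log m)` ⇒ poly (≤ `2^{O(S²)}` profiles); the crux can only fail for `S ∈ [log m, poly(m)]`
through a pencil visiting super-polynomially many defect PROFILES — the clustered version of which is
exactly the corner-polyhedron pencil of ideas annihilator-recurrence / torsion-corner-shadows
(measured ≈ q/2, linear, q ≤ 53, kit j008864).  Gomory's filter `Π(1+n_τ) ≤ q` leaves only
`(log q)^{u−1}` admissible profiles on a fixed support of `u` types (measured: pencil chains ≤ 7 for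
u = 2,3 and prime q ≤ 25601, this seat), so a long pencil must march through many SUPPORTS. -/
theorem note_lagrangian_window : True := trivial

/-- **N8. The slot/translate analysis: why every explicit amplification is one-shot.**
Write a block merge as `P^J_γ = ⋃_g P^{J₁}_g ⊕ P^{J₂}_{γ−g}` (fibres of the label map).  (i) TRANSLATES
ARE USELESS: `conv(⋃_i (K + x_i)) = conv K ⊕ conv{x_i}`, so a union of translates of one polygon has
`#vert K + #vert conv{x_i}` vertices — each slope direction is served by one translate.  (ii) For the
union over `g` of the `q` polygons `Q_g = P¹_g ⊕ P²_{γ−g}` to keep `Σ_g (#P¹_g + #P²_{γ−g})` vertices,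
the `Q_g` need pairwise slope-disjoint vertex fans ("slots") and convexly compatible positions; since
`slopes(Q_g) ⊇ slopes(P¹_g) ∪ slopes(P²_{γ−g})`, block 2 must contribute NO fan of its own wherever
block 1 does (derivation: the dominance inequalities `a_g − a_{g−δ} > max_h (b_{h+δ} − b_h)` on
slot¹(g) and the mirror ones on slot²(h) cannot both hold with fans on both sides).  (iii) ONE
multiplication is realisable on a dissociated frame: pieces `B_{g'}` (arcs in slot g', two-part labels
(1, g')) + a "cluster line" (many items of label (0,1) and vector ≈ v): fibre (1,g) =
`⋃_{g'} (B_{g'} − g'v) + gv` keeps `Σ_{g'} #B_{g'}` vertices — but that is ≤ `m`, and the OUTPUT fibres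
are translates of one polygon (or sliding windows of one convex chain), i.e. they have no
fibre-specific slots, so by (i) a second cluster line adds `+2`, and re-slotting them (hiding all but
slot g by a dominating polygon) divides by exactly the factor the next multiplication would regain.
(iv) The same bookkeeping kills exact conics beyond `m = 3`: `(τ·l)²` is fibre-additive iff
`off-diag(ττᵀ) = off-diag(sym(αᵀL))` for the label matrix `α ∈ ℤ^{r×m}`; rank forces `α ∥ τ` on all
but `2r+1` coordinates ⇒ `V ≤ t^{2r+1}` while `k ≥ t^r`.  CONSEQUENCE for counterexample hunters: a
super-polynomial fibre needs, at `Θ(log m)` nested scales simultaneously, partner blocks whose fibres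
are pairwise NON-translates, individually rich, and slot-disjoint exactly where the other side is
rich — no mechanism producing this is known; every construction tried (this seat: pieces+cluster,
colour-separated pieces, sliding windows, convex cluster curves; cycle 1: parabola blocks, staircases,
divers) is additive after the first level. -/
theorem note_slots : True := trivial

/-- **N9. Data added this cycle (exact hull DP `kit/fibrehull.py`; annealer `kit/c1_search.py`;
corner pencils `kit/corner_pencil_u.py`; all in the disprover folder, in-seat sizes).**
* parity designs (k = 2: `Π(1+X^{d_j}) + Π(1−X^{d_j})`, survivors = even subsets), vectors annealed:
  `V = 4, 8, 8, 14, 12, 20, 16, 26, 20, 32` for `m = 3..12` — `V = 3m − 4` for even m; bound `4m+2`.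
* general k = 2, t = 2 designs, coefficients in `{0} ∪ μ_N` (N = 2,3,4,5,6), alive patterns and vectors
  annealed, m = 5..8: best `V/(kmt+2)` = 0.50, 0.69, 0.50, 0.71 (m = 8: V = 24 with μ₄).
* corner pencils on a FIXED support of u types, prime q = 101 … 25601, random labels/costs (90 pencils
  per q): longest chain 4–6 (u = 2), 5–7 (u = 3); Gomory-admissible candidates 4–59.
Observation (not a claim): in every family computed by anyone on this crux the count stays below the
NO-CANCELLATION bound, i.e. the `C = 1` form `V ≤ k·m·t + 2` holds (parity 3m−4 < 4m+2; parabola block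
3t²/4 < 9t²−6t+2; r-sets m·e^{O(√log m)} < 2m²; corner pencils ≈ q/2 < 2q·m).  `C = 1` is tight at
k = 1 (m generic t-gons: V = mt).  A prover may want to test the sharp conjecture "cancellation never
increases the vertex count on a dissociated frame" at k = 2 first. -/
theorem note_data_cycle2 : True := trivial

/-- **N10. The support-function / (min,+) form of the recursion, and three exact reductions.**
(a) For a block `J` with label classes `g`, let `h_g(θ)` be the support function of fibre `g`
(`V(g)` = its number of breakpoints on the circle).  A merge is `h^J_γ = max_g (h^{J₁}_g + h^{J₂}_{γ−g})`
pointwise in `θ`; a breakpoint of `h^J_γ` is INHERITED (a breakpoint of the current argmax pair) or a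
SWITCH of the argmax, and between two switches involving the same pair one of the two functions has a
breakpoint, so switches ≤ inherited + O(q) per fibre: abundance can only be inherited, and an inherited
breakpoint of `h^{J₁}_g` can serve fibre `γ` only on the θ-range where `g` is γ's argmax.  Window
bookkeeping (N8) then shows: block 2 breakpoint-free (cluster line) ⇒ ×q for the potential but outputs
are tilts `h̃ + ρ·ℓ` of ONE function; block 2 with its own θ-windows ⇒ its potential is usable once;
present classes `H₂ ⊊ G` ⇒ output windows are the sliding patterns `ρ − H₂`, and two such outputs can be
combined at the next level only if `(H₂ − H₂) ∩ (H₃ − H₃) = {0}` (digit structure) — which merely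
SELECTS sub-collections of the original piece fans: the end count never exceeds the number of leaf
breakpoints it inherits from, `≤ #letters`, unless some block has fibres with composite richness, which
costs rank (parabola block: `t²` from `3t` letters at rank `3t`; r-sets: `n·e^{O(√log n)}` at rank n).
(b) TWO-BLOCK ADDITIVITY is a theorem, not a heuristic: representations of `ρ` by one letter from each of
two blocks form the sum graph `{(i,j) : s_i + s'_j = ρ}`, which is a disjoint union of complete bipartite
graphs (K₂,₂-closed), so the envelope is `min_σ (F_σ + G_{ρ−σ})` (class envelopes `F`, `G`), with
`O(Σ_σ (|F_σ| + |G_{ρ−σ}|)) = O(#types)` pieces (a line lies below a concave envelope on ≤ 2 intervals):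
pairs never beat linear (ideator 2's `(q−3)/2` is optimal up to the constant).  (c) REDUCTIONS
(all elementary, recorded for planners): (i) integer-partition pencils (parts `≤ u`, cost lines) ≤
`u ×` corner pencils over `ℤ/i*` with `u` types, `i* =` the LP-optimal part (prefix-sum pigeonhole in
`ℤ/i*`: fewer than `i*` non-`i*` parts in an optimal partition; reduced costs stay linear on each `i*`-interval) — measured
chains ≤ 1.25·u for u ≤ 32 (annealed, this seat); (ii) level sets with weights `≤ S` ≤ poly(m,t) ×
pencils of balanced defect profiles with ≤ 2S+1 coins (N7); (iii) survivors `Λ⁻¹(U)` ≤ `|U| ×` level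
sets (§4.1).  So every abelian-design refutation must exhibit ONE object: a positive 2-D pencil of a
(bounded) Gomory corner polyhedron `P(ℤ_q, ρ)` with `q^{ω(1)}` breakpoints, necessarily marching
through `q^{ω(1)}` distinct SUPPORTS (Gomory's filter leaves `(log q)^{u−1}` profiles per support). -/
theorem note_minplus : True := trivial

/-- The `C = 1` (no-cancellation-count) form of the crux, recorded as the natural STRENGTHENING that has
survived every search so far (N9).  Not asserted; here so that ideators/provers can name it. -/
def DissociatedSharp : Prop :=
  ∀ (k m t : ℕ) (A : Fin m → Finset (Fin 2 →₀ ℕ)) (f : Fin k → Fin m → MvPolynomial (Fin 2) ℂ),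
    (∀ j, (A j).card ≤ t) → (∀ i j, (f i j).support ⊆ A j) →
    (∀ a b : Fin m → (Fin 2 →₀ ℕ), (∀ j, a j ∈ A j) → (∀ j, b j ∈ A j) → ∑ j, a j = ∑ j, b j → a = b) →
    (Set.extremePoints ℝ (convexHull ℝ ((fun e : Fin 2 →₀ ℕ => fun i : Fin 2 => ((e i : ℕ) : ℝ)) ''
      ((∑ i, ∏ j, f i j).support : Set (Fin 2 →₀ ℕ))))).ncard ≤ k * m * t + 2

/-- `DissociatedSharp` implies the crux with `C = 1`. -/
theorem dissociatedUniform_of_sharp (h : DissociatedSharp) :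
    Summit.ValiantsHypothesis.ValiantsHypothesis.Theses.NewtonUnitEquations.DissociatedUniform :=
  ⟨1, fun k m t A f hcard hsupp hdis => by simpa using h k m t A f hcard hsupp hdis⟩

end Summit.ValiantsHypothesis.ValiantsHypothesis.Cruxes.DissociatedUniform.Disproof
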